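import Summits.CriticalPhenomena.PercolationContinuityZ3.Theorems.Transplant.FKConnectivityAllQAntipodalX2SpineDefs
import HarnessLib

/-!
# Connectivity correlation inequalities for `φ_{w,q}` — file (DEFINITION): the antipodal up-correlation functional with a WIRED marked
# edge (`apUpc` of the contraction `M/z`, written on `M`)

Definitions file (`--supports stmt-CriticalPhenomena-4575`), FK sub-lane `prim-bschramm-fk-2` (gen 14); builds on p205010 (kernel theorem,
internal audit signed; external expert review pending).  No named facts, no sorries; standard axioms.

`FK.apUpcW q T s t u v h = ∑_{C ⊆ T} q^{k(C ∪ z) + k((T∖C) ∪ z)} · (1{s ↔ t in C ∪ z} - 1{s ↔ t in (T∖C) ∪ z}) · h(C)`, `z = uv`: Theorem U's functional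
for the CONTRACTION `M/z` of a two-terminal network `M ∋ z` (`T = M ∖ z`), written on `M` itself with `z` present in both members of every
pair (memo `bschramm/FROM-fk-2-g14-X2POS.md` §5.6–5.7: the `q²`-term of the parallel twin `U¹¹(y ∥ M) = q^σ[q²·apUpcW + (1-q)·apX2Dual]`).
The sibling `…AntipodalWiredUpc.lean` proves `apUpcW ≥ 0` on two-terminal series–parallel networks for every `q > 0`.
[cite: Grimmett2006, §1.4 eq. (1.20) (p. 15); §3.8 (pp. 61–62)]
-/

noncomputable section

namespace Summit.CriticalPhenomena.PercolationContinuityZ3.Theorems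

namespace FK

open SimpleGraph Literature.Probability.LatticeModels Literature.Probability.Percolation
open scoped Classical

variable {V : Type*}

/-- **Antipodal up-correlation functional with the marked edge `z = uv` wired** (open in both members of every pair):
`∑_{C ⊆ T} q^{k(C∪z)+k((T∖C)∪z)} (1{s↔t in C∪z} - 1{s↔t in (T∖C)∪z}) h(C)` — `apUpc` of the contraction `M/z` written on `M`.
[cite: Grimmett2006, §1.4 eq. (1.20) (p. 15); §3.8 (pp. 61–62)] -/
def apUpcW (q : ℝ) (T : Finset (Sym2 V)) (s t u v : V) (h : Finset (Sym2 V) → ℝ) : ℝ :=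
  ∑ C ∈ T.powerset,
    q ^ (clusterCount (↑(insert s(u, v) C) : BondConfig V) ∅ + clusterCount (↑(insert s(u, v) (T \ C)) : BondConfig V) ∅) *
      ((apConn (insert s(u, v) C) s t - apConn (insert s(u, v) (T \ C)) s t) * h C)

/-- On the empty sub-network the wired functional vanishes (both members are `{z}`). [folklore] -/
theorem apUpcW_empty (q : ℝ) (s t u v : V) (h : Finset (Sym2 V) → ℝ) : apUpcW q ∅ s t u v h = 0 := by
  unfold apUpcW
  rw [Finset.powerset_empty, Finset.sum_singleton, Finset.sdiff_self]
  ring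

end FK

end Summit.CriticalPhenomena.PercolationContinuityZ3.Theorems

end
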